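import Literature.Barriers.QuantumAdvantage.PSimFPRun
import Literature.Barriers.QuantumAdvantage.PBlockedSimDescription
import Literature.Barriers.QuantumAdvantage.BoundedEntanglementReadout
import HarnessLib

/-!
# The `p`-blocked simulator in typed polynomial time, IV: the decision from the input string

Topic `Literature/Barriers/QuantumAdvantage`; last file of the polynomial-time certificate of the
program `PSim` (`PBlockedSim.lean`), the classical machine of Jozsa–Linden's lemma `ratpbl` /
theorem `pblthm` (Proc. R. Soc. A 459 (2003), §3). `PSimFPRun.lean` computes the decision bit from the
typed input `(W, m, gates, x)`; `PBlockedSimDescription.lean` computes that typed input from the input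
string of a polynomial-time uniform family (the description of the `|z|`-th circuit, the width
`|F.descFn z| + 2`). Composed:

* `simDecide_codeFP_inE` — the decision on the format `inE`;
* **`simDecide_descFn_mem_FP`** — for a uniform Clifford+`T` family and every block bound `p`,
  `z ↦ [simDecide p (|F.descFn z| + 2) |z| (ancillas |z|) (gate views of F.circ |z|) z] ∈ FP`;
* the assembly modulo the specification half: `pDecision_mem_FP_of_simDecide_eq` and
  **`jozsaLinden2003_pblocked_of_simDecide_eq`** — if on every oracle-free, uniform family with
  `p`-blocked states that bit is `pDecision F z` (`BoundedEntanglementReadout.lean`), the named fact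
  follows (`jozsaLinden2003_pblocked_of_decisionInFP`). The specification itself is the sibling line
  of files `PBlockedSimIdealTables.lean`, ….

## References

* R. Jozsa, N. Linden, *On the role of entanglement in quantum-computational speed-up*, Proc. R. Soc.
  Lond. A 459 (2003) 2011–2032, arXiv:quant-ph/0201143: §3, theorem `pblthm`, proof of lemma `ratpbl`.
* S. Arora, B. Barak, *Computational Complexity: A Modern Approach*, CUP 2009, §6.2, §1.3.
-/

noncomputable section

namespace Literature.Barriers.QuantumAdvantage

namespace PSim

open _root_.Computability Literature.Computability.Complexity Literature.Computability.Complexity.CodeFP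
  Literature.Computability.Cryptography

/-- The decision bit on the typed input format `inE` of `PBlockedSimDescription.lean` (the same code
as `simInE`): definitionally the statement of `simDecide_codeFP` (`PSimFPRun.lean`), kept under its
old name as a deprecated alias (dedup-00688); use `simDecide_codeFP`.
[cite: JozsaLinden2003, §3 (theorem pblthm)] -/
@[deprecated simDecide_codeFP (since := "2026-08-15")]
theorem simDecide_codeFP_inE (p : ℕ) : CodeFP inE bitE (fun t => simDecide p t.1 t.2.2.2.length t.2.1 t.2.2.1 t.2.2.2) :=
  simDecide_codeFP p

/-- **For a uniform family the simulation runs in polynomial time on the input string**: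
`z ↦ [simDecide p (|F.descFn z| + 2) |z| (ancillas |z|) (gate views of F.circ |z|) z] ∈ FP` — the
machine of lemma `ratpbl` fed with the description of the `|z|`-th circuit (uniformity) and the width
`|F.descFn z| + 2 ≥ h + 2` (`hExp_add_two_le_width`). Its correctness on `p`-blocked oracle-free runs
(`= pDecision F z`) is the specification half. [cite: JozsaLinden2003, §3 (theorem pblthm: "can be classically efficiently simulated"; proof of lemma ratpbl)] -/
theorem simDecide_descFn_mem_FP (p : ℕ) {F : QCircuitFamily cliffordT} (hU : F.IsUniform) :
    (fun z => [simDecide p ((F.descFn z).length + 2) z.length (F.ancillas z.length)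
      (((F.circ z.length).gates.map rawOf).map gate3OfRaw) z]) ∈ FP := by
  obtain ⟨f, hf, hfg⟩ := (simDecide_codeFP p).comp (inputs_codeFP hU)
  have : f = fun z => [simDecide p ((F.descFn z).length + 2) z.length (F.ancillas z.length)
      (((F.circ z.length).gates.map rawOf).map gate3OfRaw) z] := funext fun z => hfg z
  rwa [this] at hf

/-! ### The assembly modulo the specification -/

/-- **The decision bit of a family is in `FP` once the simulation computes it**: if the simulator's
bit on the description of the `|z|`-th circuit is `pDecision F z` for every `z`, then
`z ↦ [pDecision F z]` is polynomial-time. [cite: JozsaLinden2003, §3 (theorem pblthm with §2: the decision version)] -/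
theorem pDecision_mem_FP_of_simDecide_eq (p : ℕ) {F : QCircuitFamily cliffordT} (hU : F.IsUniform)
    (hspec : ∀ z, simDecide p ((F.descFn z).length + 2) z.length (F.ancillas z.length)
      (((F.circ z.length).gates.map rawOf).map gate3OfRaw) z = pDecision F z) :
    (fun z => [pDecision F z]) ∈ FP := by
  have h := simDecide_descFn_mem_FP p hU
  have : (fun z => [simDecide p ((F.descFn z).length + 2) z.length (F.ancillas z.length)
      (((F.circ z.length).gates.map rawOf).map gate3OfRaw) z]) = fun z => [pDecision F z] :=
    funext fun z => by rw [hspec z]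
  rwa [this] at h

/-- **Jozsa–Linden's theorem `pblthm` from the specification of the program**: if for every block
bound `p` and every oracle-free, polynomial-time uniform Clifford+`T` family with `p`-blocked states the
simulator's bit on the description of the `|z|`-th circuit (width `|F.descFn z| + 2`) equals the exact
decision bit `pDecision F z`, then `jozsaLinden2003_pblocked` holds — the machine half being
`simDecide_descFn_mem_FP` and the read-out `jozsaLinden2003_pblocked_of_decisionInFP`.
[cite: JozsaLinden2003, §3 (theorem pblthm, proof of lemma ratpbl) with §2] -/
theorem jozsaLinden2003_pblocked_of_simDecide_eq
    (hspec : ∀ (p : ℕ) (F : QCircuitFamily cliffordT), F.IsOracleFree → F.IsUniform → F.HasPBlockedStates p →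
      ∀ z, simDecide p ((F.descFn z).length + 2) z.length (F.ancillas z.length)
        (((F.circ z.length).gates.map rawOf).map gate3OfRaw) z = pDecision F z) :
    jozsaLinden2003_pblocked :=
  jozsaLinden2003_pblocked_of_decisionInFP fun p F hF hU hP =>
    pDecision_mem_FP_of_simDecide_eq p hU (hspec p F hF hU hP)

end PSim

end Literature.Barriers.QuantumAdvantage

end
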